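import Summits.BirchSwinnertonDyer.BirchSwinnertonDyer.Theorems.ManinLocalTwoThreeManinPrimeToAdditiveFiveLeStarredTwinOfTwistAdditive
import Summits.BirchSwinnertonDyer.BirchSwinnertonDyer.Theorems.AdditiveKolyvaginRoadIstarIsogenyInvariance
import Summits.BirchSwinnertonDyer.Rank1Residual.X12.InertBadGoodTwist
import Summits.BirchSwinnertonDyer.BirchSwinnertonDyer.Theses.TwistFamilyManinDescent
import HarnessLib

/-!
# Route `ManinLocalTwoThree`, residual crux C5 `ManinPrimeToAdditiveFiveLe`
# (stmt-BirchSwinnertonDyer-22969), line `upper_anchor` (skeleton v11: `stub_ord57` :=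
# `TwistFamilyManinDescent.OrdinaryCornerManinResidual`, stmt-27552, BY NAME): **the bridge between the two
# decompositions of the potentially-ordinary residue — K18b `OrdinaryCornerUnstarredNotBottom` (stmt-27558) ⟸
# Modularity ∧ E-imc-9 `OrdinaryRamifiedTwistLaw 5` ∧ `OrdinaryRamifiedTwistLaw 7`**

Width seat bsd-line-ml23-c5-p1-w3 (gen 0), piece ω (sequel of φ p628074/p628721 and χ p629396/p629809). Context
(C5 lead gen 6, skeleton v11, 2026-08-28T11:27Z): C5's skeleton of record is a pure by-name assembly whose
potentially-ordinary `W[p]`-reducible content at `p ∈ {5, 7}` is the route `TwistFamilyManinDescent`'s node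
`OrdinaryCornerManinResidual` (27552). That route cuts 27552 as `OrdinaryCornerOfWildDichotomy` (27560, proved
there): K18a `OrdinaryCornerWildEdixhovenDichotomy` (27557: `p ∣ c ⟹ unstarred ∧ BOTTOM`) ∧ **K18b
`OrdinaryCornerUnstarredNotBottom` (27558: the optimal unstarred curve is never in Edixhoven's case 1 — NOT
`g(χ) Λ(f ⊗ χ) ⊆ p Λ(f)`)** ∧ K18t (27559, tame residual); the cell bsd-f2-manin cuts the same content by the
imc planner's law E-imc-9 `OrdinaryRamifiedTwistLaw p` («from the unstarred end the ramified twist is optimal with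
degree exactly `p · deg`»; this seat's χ: 27552 ⟸ its starred rows ∧ E-imc-9(5, 7)). The lead asked the planners
to book ONE of the two decompositions. THIS FILE proves, kernel-checked, that they overlap exactly where expected:

* §1 `dirichletCharacter_eq_quadraticChar_of_isQuadratic_of_isPrimitive` — the quadratic primitive Dirichlet
  character mod an odd prime is the Legendre symbol (plumbing for K18b's `∀ χ` binder).
* §2 `twist_pStar_additiveAt_of_forall_ne_Istar` — no `Iₙ*` fibre at an odd `p` ⟹ `W ⊗ p*` is neither good nor
  multiplicative at `(p)` (Tate's algorithm Steps 6–7 read backwards); removes the twist-additivity clause of the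
  χ-packet on unstarred rows.
* §3 `ordinaryCornerUnstarredNotBottom_of_ordinaryRamifiedTwistLaws` — **K18b BY NAME ⟸ `exists_isNewformOf` ∧
  `OrdinaryRamifiedTwistLaw 5` ∧ `OrdinaryRamifiedTwistLaw 7`**; K18b's reducibility and wild-inertia binders are
  idle (E-imc-9 says «always TOP» on every potentially-ordinary unstarred optimal orbit). Mechanism: χ-packet
  (commuting lattice-optimal twin with `deg₀ = p · deg`) + the an-cell's PROVED index engine (`m · m′ = p²`,
  `m · deg₀ = p · deg` ⟹ `m = 1`, `m′ = p²`) + «twin's newform = `f ⊗ χ`» ⟹ BOTTOM would give `m′ = 1`.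

Census consistency (route TwistFamilyManinDescent, evidence I8; cell LEDGER gen 4): configuration TOP at 532/532
reducible ordinary corner pairs `N ≤ 5·10⁵`, i.e. `v_p(deg φ_unstarred) = v_p(deg φ_starred) − 1` — the same data
that REF1 read as 85 108 / 85 108 exact ratio `p` for E-imc-9.

HONEST STATUS. Conditional result (`--supports` the C5 crux as a helper) between OPEN statements: E-imc-9 is a
registered, refuter-vetted conjecture of the cell (not in print); K18b stays open unconditionally. Nothing here
proves 27552, C5, Manin's conjecture or BSD. No summit statement is proved by this seat.

References: [EdixhovenManin1991] §4; [Stevens1989] (5.4)–(5.5); [ZagierCMB1985] §1; [DiamondShurman2005] §5.8,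
Thm. 8.8.3; [SilvermanATAEC1994] IV.9.4 Steps 6–7; [SilvermanAEC2009] X.5 Cor. 5.4; cell bsd-f2-manin MEMO-imc.md
§10 (E-imc-9); route TwistFamilyManinDescent thesis LINE 18 (27557–27560).
-/

set_option autoImplicit false
-- the Theorems namespace of this sub repeats the summit name by design (D-0017 nested layout)
set_option linter.dupNamespace false

noncomputable section

open scoped Classical NumberField

namespace Summit.BirchSwinnertonDyer.BirchSwinnertonDyer.Theorems

open WeierstrassCurve IsDedekindDomain IsDedekindDomain.HeightOneSpectrum Rat.HeightOneSpectrum NumberField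
  Literature.NumberTheory.EllipticCurves Literature.NumberTheory.EllipticCurves.ModularForms
  Literature.NumberTheory.EllipticCurves.Rank1Residual
  Literature.NumberTheory.DiophantineGeometry
  Summit.BirchSwinnertonDyer.Rank1Residual.ManinAdditive
  Summit.BirchSwinnertonDyer.Rank1Residual.Additive

/-! ## §1 The quadratic primitive character mod an odd prime -/

/-- **The quadratic primitive Dirichlet character mod an odd prime `p` is the Legendre symbol** (as the
`ℂ`-valued `ringHomComp` of Mathlib's `quadraticChar (ZMod p)`): `(ZMod p)ˣ` is cyclic, a quadratic character
takes the value `±1` on a generator, the value `1` would make it trivial (conductor `1 ≠ p`), and the Legendre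
symbol is `-1` somewhere (`quadraticChar_exists_neg_one'`), hence `-1` on the generator too. Plumbing for the
`∀ χ quadratic primitive` binder of K18b. [folklore] -/
theorem dirichletCharacter_eq_quadraticChar_of_isQuadratic_of_isPrimitive {p : ℕ} [Fact p.Prime]
    (hp2 : p ≠ 2) (χ : DirichletCharacter ℂ p) (hχ : χ.IsQuadratic) (hprim : χ.IsPrimitive) :
    χ = (quadraticChar (ZMod p)).ringHomComp (Int.castRingHom ℂ) := by
  have hp : p.Prime := Fact.out
  obtain ⟨g, hg⟩ := IsCyclic.exists_generator (α := (ZMod p)ˣ)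
  set ψ : DirichletCharacter ℂ p := (quadraticChar (ZMod p)).ringHomComp (Int.castRingHom ℂ) with hψ
  -- a Dirichlet character is determined on units by its value at the generator `g`
  have hunit : ∀ (φ : DirichletCharacter ℂ p) (k : ℤ),
      φ ((g ^ k : (ZMod p)ˣ) : ZMod p) = (((MulChar.toUnitHom φ g) ^ k : ℂˣ) : ℂ) := by
    intro φ k
    rw [← map_zpow, MulChar.coe_toUnitHom]
  -- a character with `φ g = 1` is trivial
  have htriv : ∀ (φ : DirichletCharacter ℂ p), φ (g : ZMod p) = 1 → φ = 1 := by
    intro φ h1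
    have hu : MulChar.toUnitHom φ g = 1 := Units.ext (by rw [MulChar.coe_toUnitHom, h1, Units.val_one])
    refine MulChar.eq_one_iff.mpr fun a ↦ ?_
    obtain ⟨k, rfl⟩ := Subgroup.mem_zpowers_iff.mp (hg a)
    rw [hunit φ k, hu, one_zpow, Units.val_one]
  -- `χ g = -1`: it is `0`, `1` or `-1`; not `0` on a unit; not `1` since `χ` is primitive of conductor `p > 1`
  have hχg : χ (g : ZMod p) = -1 := by
    rcases hχ (g : ZMod p) with h | h | h
    · exfalso
      rw [← MulChar.coe_toUnitHom] at h
      exact (MulChar.toUnitHom χ g).ne_zero h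
    · exfalso
      have hc : χ.conductor = 1 := (DirichletCharacter.eq_one_iff_conductor_eq_one).mp (htriv χ h)
      rw [(DirichletCharacter.isPrimitive_def χ).mp hprim] at hc
      exact hp.one_lt.ne' hc
    · exact h
  -- `ψ g = -1`: otherwise `ψ` is trivial, but the Legendre symbol takes the value `-1` somewhere
  have hψg : ψ (g : ZMod p) = -1 := by
    have hF : ringChar (ZMod p) ≠ 2 := by rw [ZMod.ringChar_zmod_n]; exact hp2
    obtain ⟨a, ha⟩ := quadraticChar_exists_neg_one' hF
    have hψa : ψ (a : ZMod p) = -1 := by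
      rw [hψ, MulChar.ringHomComp_apply, ha]; simp
    have hq : ψ.IsQuadratic := (quadraticChar_isQuadratic (ZMod p)).comp _
    rcases hq (g : ZMod p) with h | h | h
    · exfalso
      rw [← MulChar.coe_toUnitHom] at h
      exact (MulChar.toUnitHom ψ g).ne_zero h
    · exfalso
      have h1 : ψ = 1 := htriv ψ h
      have : ψ (a : ZMod p) = 1 := by rw [h1, MulChar.one_apply_coe]
      rw [hψa] at this
      norm_num at this
    · exact h
  -- conclude on units: both characters send `g ^ k` to `(-1) ^ k`
  have hχu : MulChar.toUnitHom χ g = MulChar.toUnitHom ψ g :=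
    Units.ext (by rw [MulChar.coe_toUnitHom, MulChar.coe_toUnitHom, hχg, hψg])
  refine MulChar.ext fun a ↦ ?_
  obtain ⟨k, rfl⟩ := Subgroup.mem_zpowers_iff.mp (hg a)
  rw [hunit χ k, hunit ψ k, hχu]

/-! ## §2 Unstarred (no `Iₙ*`) ⟹ the `p*`-twist is additive at `p` -/

/-- **No `Iₙ*` fibre at an odd `p` ⟹ the twist `W ⊗ p*` is neither good nor multiplicative at the place
`(p)`** (any equation `W/ℚ`). If `W ⊗ p*` were semistable at `p`, its globally minimal model `V` would be good
or multiplicative at the place of `𝓞 ℚ` over `p` (model invariance `hasGoodReductionAt_smul_iff_holds` /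
`hasMultiplicativeReductionAt_smul_iff_holds`, prime/place bridges), `W ≅ C' • (V ⊗ p*)` (twisting twice,
`X12.exists_smul_twist_eq_of_smul_eq_twist`), and Tate's algorithm Steps 6–7 on the uniformiser twist of a
semistable equation (`Additive.kodairaSymbolAt_twist_of_semistable`) would give `W` the type `Iₙ*`. This removes
the «`W ⊗ p*` additive» clause of the χ-packet on the unstarred rows (`ord_p Δ_min ≤ 4` ⟹ no `Iₙ*`).
[cite: SilvermanATAEC1994, IV.9.4 Steps 6–7 (PDF pp. 345–346)] [cite: SilvermanAEC2009, X.5 Cor. 5.4] -/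
theorem twist_pStar_additiveAt_of_forall_ne_Istar (W : WeierstrassCurve ℚ) [W.IsElliptic] {p : ℕ}
    (hp : p.Prime) (hp2 : p ≠ 2)
    (hI : ∀ n : ℕ, W.kodairaSymbolAt ((Rat.HeightOneSpectrum.primesEquiv (R := ℤ)).symm ⟨p, hp⟩) ≠ .Istar n) :
    ¬ ((W.quadraticTwist (((-1 : ℤ) ^ (p / 2) * p : ℤ) : ℚ)).HasGoodReductionAt
          ((Rat.HeightOneSpectrum.primesEquiv (R := ℤ)).symm ⟨p, hp⟩) ∨
        (W.quadraticTwist (((-1 : ℤ) ^ (p / 2) * p : ℤ) : ℚ)).HasMultiplicativeReductionAt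
          ((Rat.HeightOneSpectrum.primesEquiv (R := ℤ)).symm ⟨p, hp⟩)) := by
  haveI hpF : Fact p.Prime := ⟨hp⟩
  obtain ⟨hd0, h1, h2⟩ := IstarIsogenyInvariance.pStar_dvd_facts hp
  set d : ℤ := (-1 : ℤ) ^ (p / 2) * p with hd
  have hd0Q : (d : ℚ) ≠ 0 := by exact_mod_cast hd0
  set T : WeierstrassCurve ℚ := W.quadraticTwist (d : ℚ) with hT
  haveI hTe : T.IsElliptic := W.isElliptic_quadraticTwist hd0Q
  -- the place of `𝓞 ℚ` over `p`
  set u : HeightOneSpectrum (𝓞 ℚ) := (primesEquiv (R := 𝓞 ℚ)).symm ⟨p, hp⟩ with hudef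
  have hu : primesEquiv u = ⟨p, hp⟩ := by rw [hudef, Equiv.apply_symm_apply]
  have hup : (primesEquiv u : ℕ) = p := by rw [hu]
  have hu2 : (primesEquiv u : ℕ) ≠ 2 := by rw [hup]; exact hp2
  rintro hgm
  -- `T` is semistable at `u`
  have hTu : T.HasGoodReductionAt u ∨ T.HasMultiplicativeReductionAt u := by
    rcases hgm with hg | hm
    · left
      have hg1 : T.HasGoodReductionAtPrime p :=
        (T.hasGoodReductionAtPrime_iff_hasGoodReductionAt_holds ⟨p, hp⟩).mpr hg
      have key := hasGoodReductionAtPrime_iff_hasGoodReductionAt_ringOfIntegers u T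
      revert key
      generalize primesEquiv u = q at hu ⊢
      subst hu
      intro key
      exact key.mp hg1
    · right
      have hm1 : T.HasMultiplicativeReductionAtPrime p :=
        (T.hasMultiplicativeReductionAtPrime_iff_hasMultiplicativeReductionAt_holds ⟨p, hp⟩).mpr hm
      have key := T.hasMultiplicativeReductionAtPrime_iff_hasMultiplicativeReductionAt_ringOfIntegers u
      revert key
      generalize primesEquiv u = q at hu ⊢
      subst hu
      intro key
      exact key.mp hm1
  -- a globally minimal model `V` of `T`, semistable at `u`, with `W ≅ C' • V ⊗ d`
  obtain ⟨V, hVe, hVm, C, hC⟩ := Summit.BirchSwinnertonDyer.Rank1Residual.X12.exists_isGloballyMinimal_smul_eq_twist W hd0Q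
  haveI := hVe
  haveI := hVm
  have hV : V.HasGoodReductionAt u ∨ V.HasMultiplicativeReductionAt u := by
    rcases hTu with hg | hm
    · left
      rw [← hasGoodReductionAt_smul_iff_holds u V C, hC]; exact hg
    · right
      rw [← hasMultiplicativeReductionAt_smul_iff_holds u V C, hC]; exact hm
  obtain ⟨C', hC'⟩ := Summit.BirchSwinnertonDyer.Rank1Residual.X12.exists_smul_twist_eq_of_smul_eq_twist W hd0Q hC
  obtain ⟨n, hn⟩ := kodairaSymbolAt_twist_of_semistable u V hu2 hd0
    (by rw [hup]; exact h1) (by rw [hup]; exact h2) hV C' hC'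
  -- read at the place of `ℤ` under `p`
  have hvu : primesEquiv ((primesEquiv (R := ℤ)).symm ⟨p, hp⟩) = primesEquiv u := by
    rw [hu, Equiv.apply_symm_apply]
  rw [← Summit.BirchSwinnertonDyer.Rank1Residual.O5.FlexNormalForm.kodairaSymbolAt_eq_of_primesEquiv_eq' W _ u hvu] at hn
  exact hI n hn

/-! ## §3 K18b from E-imc-9 -/

/-- **K18b `TwistFamilyManinDescent.OrdinaryCornerUnstarredNotBottom` (stmt-BirchSwinnertonDyer-27558) BY NAME ⟸
Modularity (`exists_isNewformOf`) ∧ E-imc-9 `OrdinaryRamifiedTwistLaw` at `5` and `7`.** K18b: for an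
`X₀(N)`-optimal `W` (lattice-optimal datum `D`, `N = N(W)`, `p² ∣ N`) on the unstarred potentially-ordinary
corner rows `(5; 3)`, `(7; 2)`, `(7; 4)` with `W[p]` reducible and WILD inertia, and the quadratic primitive `χ`
mod `p`: NOT `g(χ) · Λ(f ⊗ χ) ⊆ p · Λ(f)` («never BOTTOM», the one configuration of Edixhoven's §4 chain allowing
`v_p(c) = 1`). PROOF from E-imc-9: `χ` is the Legendre symbol (uniqueness above); `ord_p Δ_min ≤ 4` ⟹ no `Iₙ*` ⟹
`W ⊗ p*` additive at `(p)`; the χ-packet gives the commuting lattice-optimal twin `(W₀, D₀)` with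
`deg(D₀) = p · deg(D)`; the an-cell's PROVED index engine on the pair (`pStar_orbit_steps` +
`optimal_orbit_index_engine`: `m · m′ = p²`, `m · deg₀ = p · deg`) then has `m = 1`, so `m′ = p²`; but the
twin's newform is `f ⊗ χ` (`cuspCoeff_eq_chi_mul_of_twist_pStar`, q-expansion principle across the equal
levels), so BOTTOM reads `G · Λ(f₀) ⊆ p · Λ(f)`, i.e. (with `G² = p* = ±p`) `Λ(f₀) ⊆ ±G · Λ(f)`, which puts
`Λ_{W₀} = c₀ Λ(f₀)` inside `(c₀ G / c) · Λ_W` and forces `m′ = 1` — so `p² = 1`, absurd. The reducibility and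
wild-inertia hypotheses of K18b are IDLE: E-imc-9 gives «never BOTTOM» (indeed «always TOP») on every
potentially-ordinary unstarred optimal orbit at `p ≥ 5`. For the planners (C5 lead's two-decompositions note,
2026-08-28T11:27Z): decomposition B's middle piece K18b of the node 27552 is implied by decomposition A's law
E-imc-9. Conditional result (`--supports` the C5 crux as a helper): E-imc-9 is an OPEN conjecture; nothing here
proves K18b unconditionally, 27552, C5, Manin's conjecture or BSD.
[cite: EdixhovenManin1991, §4 (case 1 / case 2)] [cite: ZagierCMB1985, §1] [cite: Stevens1989, (5.4)–(5.5)]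
[cite: DiamondShurman2005, §5.8 and Thm. 8.8.3] -/
theorem ordinaryCornerUnstarredNotBottom_of_ordinaryRamifiedTwistLaws (hnf : exists_isNewformOf)
    (hO5 : OrdinaryRamifiedTwistLaw 5) (hO7 : OrdinaryRamifiedTwistLaw 7) :
    Summit.BirchSwinnertonDyer.BirchSwinnertonDyer.Theses.TwistFamilyManinDescent.OrdinaryCornerUnstarredNotBottom := by
  intro W _ _ p _ _ D hsq hrow _hred hD _hwild χ hχ hprim hbottom
  have hp : p.Prime := Fact.out
  have hrow' : (p = 5 ∧ padicValInt p W.minimalDiscriminantInt = 3) ∨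
      (p = 7 ∧ padicValInt p W.minimalDiscriminantInt = 2) ∨ (p = 7 ∧ padicValInt p W.minimalDiscriminantInt = 4) := by
    rcases hrow with ⟨rfl, h⟩ | ⟨rfl, h⟩
    · exact Or.inl ⟨rfl, h⟩
    · have h' : padicValInt 7 W.minimalDiscriminantInt = 2 ∨ padicValInt 7 W.minimalDiscriminantInt = 4 := by
        simpa using h
      rcases h' with h' | h'
      · exact Or.inr (Or.inl ⟨rfl, h'⟩)
      · exact Or.inr (Or.inr ⟨rfl, h'⟩)
  have h57 : p = 5 ∨ p = 7 := by rcases hrow' with ⟨h, -⟩ | ⟨h, -⟩ | ⟨h, -⟩ <;> simp [h]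
  have h5 : 5 ≤ p := by rcases h57 with rfl | rfl <;> norm_num
  have hp2 : p ≠ 2 := by omega
  -- `χ` is the Legendre symbol mod `p`
  obtain rfl := dirichletCharacter_eq_quadraticChar_of_isQuadratic_of_isPrimitive hp2 χ hχ hprim
  have hO : OrdinaryRamifiedTwistLaw p := by
    rcases h57 with rfl | rfl
    · exact hO5
    · exact hO7
  have hadd : Addv W p := not_good_and_not_mult_of_sq_dvd_conductorNorm W hsq
  have hv4 : padicValInt p W.minimalDiscriminantInt ≤ 4 := by
    rcases hrow' with ⟨-, h⟩ | ⟨-, h⟩ | ⟨-, h⟩ <;> omega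
  have he : 12 / Nat.gcd 12 (padicValInt p W.minimalDiscriminantInt) ∣ p - 1 := by
    rcases hrow' with ⟨rfl, h⟩ | ⟨rfl, h⟩ | ⟨rfl, h⟩ <;> rw [h] <;> decide
  -- no `Iₙ*` fibre (`ord_p Δ_min ≤ 4`), hence `W ⊗ p*` is additive at `(p)`
  have hI : ∀ n : ℕ, W.kodairaSymbolAt ((Rat.HeightOneSpectrum.primesEquiv (R := ℤ)).symm ⟨p, hp⟩) ≠ .Istar n := by
    intro n hn
    have hn' : W.kodairaSymbolAt (placeOf p) = .Istar n := hn
    rcases kodairaSymbolAt_placeOf_cases_of_addv W p h5 hadd with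
      ⟨hk, -⟩ | ⟨hk, -⟩ | ⟨hk, -⟩ | ⟨m, -, hv⟩ | ⟨-, hv⟩ | ⟨-, hv⟩ | ⟨-, hv⟩
    · rw [hn'] at hk; cases hk
    · rw [hn'] at hk; cases hk
    · rw [hn'] at hk; cases hk
    all_goals omega
  have htwadd := twist_pStar_additiveAt_of_forall_ne_Istar W hp hp2 hI
  -- the χ-packet: the commuting lattice-optimal starred twin
  obtain ⟨W₀, hE₀, hM₀, hne₀, u, D₀, hD₀, hu, hiso, -, hNN, hpN₀, hup, -, -⟩ :=
    exists_commuting_starred_twin_of_twistAdditive_of_ordinaryRamifiedTwistLaw hnf hp h5 hO W D hD hsq htwadd hv4 he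
  haveI := hE₀
  haveI := hM₀
  haveI := hne₀
  -- the Gauss sum of the Legendre symbol
  set G : ℂ := gaussSum ((quadraticChar (ZMod p)).ringHomComp (Int.castRingHom ℂ))
    (ZMod.stdAddChar (N := p)) with hGdef
  set ε : ℤ := (-1 : ℤ) ^ (p / 2) with hεdef
  have hε2 : (ε : ℂ) * ε = 1 := by
    rw [hεdef]; push_cast
    rw [← pow_add, ← two_mul, pow_mul, neg_one_sq, one_pow]
  have hG2 : G ^ 2 = (ε : ℂ) * (p : ℂ) := by
    rw [hGdef, gaussSum_quadraticChar_ringHomComp_sq p hp2, hεdef]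
    push_cast
    ring
  have hG0 : G ≠ 0 := by
    intro h0
    have : (ε : ℂ) * (p : ℂ) = 0 := by rw [← hG2, h0]; simp
    rcases mul_eq_zero.mp this with h | h
    · have : (ε : ℂ) * ε = 0 := by rw [h, zero_mul]
      rw [hε2] at this; exact one_ne_zero this
    · exact hp.ne_zero (by exact_mod_cast h)
  have ha : ‖G‖ ^ 2 = p := by
    rw [← norm_pow, hG2, norm_mul, hεdef]
    push_cast
    rw [norm_pow, norm_neg, norm_one, one_pow, one_mul, Complex.norm_natCast]
  -- the index engine on the commuting pair: `m · m′ = p²`, `m · deg₀ = p · deg`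
  obtain ⟨h1, h2, hcoef⟩ := pStar_orbit_steps hp2 D D₀ hsq hNN hiso
  have hc₀ : (D₀.c : ℂ) ≠ 0 := by exact_mod_cast D₀.maninConstant_ne_zero_holds
  have hc₁ : (D.c : ℂ) ≠ 0 := by exact_mod_cast D.maninConstant_ne_zero_holds
  have ht : (D.c : ℂ) * G / (D₀.c : ℂ) ≠ 0 := div_ne_zero (mul_ne_zero hc₁ hG0) hc₀
  have ht' : (D₀.c : ℂ) * G / (D.c : ℂ) ≠ 0 := div_ne_zero (mul_ne_zero hc₀ hG0) hc₁
  obtain ⟨hmm, hmdeg⟩ := optimal_orbit_index_engine hNN D D₀ hD hD₀ ha h1 h2 hcoef ht ht'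
  -- `deg₀ = p · deg` forces `m = 1`, hence `m′ = p²`
  have hpos : 0 < D₀.modularDegree := D₀.deg_pos
  have hm1 : (D₀.L.mulLeft _ ht).lattice.toAddSubgroup.relIndex D.L.lattice.toAddSubgroup = 1 := by
    refine Nat.eq_of_mul_eq_mul_right hpos ?_
    rw [one_mul, hmdeg, hup]
  rw [hm1, one_mul] at hmm
  -- BOTTOM would force `m′ = 1`: the twin's newform is `f ⊗ χ`, and `Λ(f ⊗ χ) ⊆ (p / G) Λ(f) = ε G Λ(f)`
  obtain ⟨hng₀, hnm₀⟩ := not_good_and_not_mult_of_sq_dvd_conductorNorm W₀ hpN₀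
  have hW₀0 : ∀ n : ℕ, p ∣ n → W₀.LFunction n = 0 := fun n hn ↦
    W₀.LFunction_apply_eq_zero_of_not_good_of_not_mult p hng₀ hnm₀ hn
  have hcoef₀ : ∀ n : ℕ, cuspCoeff D₀.f n =
      (quadraticChar (ZMod p)).ringHomComp (Int.castRingHom ℂ) n * cuspCoeff D.f n := fun n ↦
    cuspCoeff_eq_chi_mul_of_twist_pStar hp2 u hu rfl hW₀0 D D₀ n
  have hχp := isPrimitive_quadraticChar_ringHomComp p hp2
  have hΛ : periodLattice (charTwist (W.conductorNorm ℤ) (dvd_refl _) hsq hχ D.f) = periodLattice D₀.f :=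
    periodLattice_eq_of_level_eq_of_cuspCoeff_eq hNN.symm _ _ fun n ↦ by
      rw [cuspCoeff_charTwist _ (dvd_refl _) hsq hχ hχp D.f n, hcoef₀ n]
  have hle : D₀.L.lattice.toAddSubgroup ≤ (D.L.mulLeft _ ht').lattice.toAddSubgroup := by
    intro z hz
    obtain ⟨w₀, hw₀, rfl⟩ := hD₀ z hz
    rw [← hΛ] at hw₀
    obtain ⟨y, hy, hGw⟩ := hbottom w₀ hw₀
    -- `w₀ = ε G y`
    have hw : w₀ = (ε : ℂ) * G * y := by
      refine mul_left_cancel₀ hG0 ?_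
      rw [hGw]
      linear_combination (-(ε : ℂ) * y) * hG2 + (-(p : ℂ) * y) * hε2
    have hεy : (ε : ℂ) * y ∈ periodLattice D.f := by
      rcases neg_one_pow_eq_or ℤ (p / 2) with h | h
      · rw [hεdef, h]; push_cast; rw [one_mul]; exact hy
      · rw [hεdef, h]; push_cast; rw [neg_one_mul]; exact neg_mem hy
    change (D₀.c : ℂ) * w₀ ∈ (D.L.mulLeft _ ht').lattice
    rw [PeriodPair.mem_mulLeft_lattice]
    have key : ((D₀.c : ℂ) * G / (D.c : ℂ))⁻¹ * ((D₀.c : ℂ) * w₀) = (D.c : ℂ) * ((ε : ℂ) * y) := by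
      rw [hw]; field_simp
    rw [key]
    exact D.smul_periodLattice_le _ hεy
  have hm'1 : (D.L.mulLeft _ ht').lattice.toAddSubgroup.relIndex D₀.L.lattice.toAddSubgroup = 1 :=
    AddSubgroup.relIndex_eq_one.mpr hle
  rw [hm'1] at hmm
  -- `1 = p²`
  have : p ^ 2 = 1 := by exact_mod_cast hmm.symm
  nlinarith [hp.two_le]

end Summit.BirchSwinnertonDyer.BirchSwinnertonDyer.Theorems

end
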